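import Literature.Geometry.Lorentzian.KillingHorizonShadowAlong
import HarnessLib

/-!
# Local Killing germs at a point

A **local Killing vector field at `p`** (a Killing germ) of a pseudo-Riemannian metric `g`: a
vector field `ξ` defined and Killing on some open neighbourhood `W` of `p` (Nomizu, Ann. of Math. 72
(1960), §1: "a Killing vector field defined on a neighborhood of a point"; O'Neill 1983, Ch. 9,
Def. 22 / Prop. 25 on the open submanifold `W`), here with the non-degeneracy `ξ(p) ≠ 0`, and its
**causal** variant `g_p(ξ, ξ) ≤ 0` (the germ is timelike or null at `p`; for a Lorentzian `g` this is
the local form of "stationary near `p`, possibly on a horizon/ergosurface").  Both are stated on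
top of the tree's `PseudoRiemannianMetric.IsKillingFieldOn` (Killing on a set), so nothing about
Killing fields is re-declared:

* `HasLocalKillingGermAt g p`, `HasCausalLocalKillingGermAt g p` (definitions);
* unfolding lemmas `hasLocalKillingGermAt_iff`, `hasCausalLocalKillingGermAt_iff` giving the FLAT
  right-nested form `∃ W ξ, IsOpen W ∧ p ∈ W ∧ ⟨ξ is Cⁿ on W⟩ ∧ ⟨Killing equation on W⟩ ∧ ξ p ≠ 0
  (∧ g_p(ξ,ξ) ≤ 0)` in which route files inline the notion;
* `HasCausalLocalKillingGermAt.hasLocalKillingGermAt`;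
* monotonicity in the neighbourhood: `….exists_subset` — the germ may be taken on an open
  neighbourhood inside any prescribed open `V ∋ p` (`IsKillingFieldOn.mono` on `W ∩ V`);
* `IsKillingField.hasLocalKillingGermAt` — a global Killing field non-zero at `p` is a germ at `p`
  (and the causal variant).

NOT here: Nomizu's extension theorems (local germs on simply connected analytic manifolds extend
globally), dimension counts of the germ algebra, anything about stationarity at infinity.
-/

noncomputable section

open Bundle Set Filter
open scoped Manifold ContDiff Topology

namespace Literature.Geometry.Lorentzian

variable {E : Type*} [NormedAddCommGroup E] [NormedSpace ℝ E] {H : Type*} [TopologicalSpace H]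
  {I : ModelWithCorners ℝ E H} {M : Type*} [TopologicalSpace M] [ChartedSpace H M]
  [IsManifold I ∞ M] {n : ℕ∞ω}

namespace PseudoRiemannianMetric

variable (g : PseudoRiemannianMetric I n E (TangentSpace I : M → Type _)) [g.HasLeviCivita]

/-- **Local Killing germ at `p`**: there are an open neighbourhood `W` of `p` and a vector field `ξ`
which is a Killing field of `g` on `W` (`IsKillingFieldOn`: `Cⁿ` on `W` and
`g(∇_Y ξ, Z) + g(Y, ∇_Z ξ) = 0` at every point of `W`) with `ξ(p) ≠ 0`.  Nomizu 1960, §1 (local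
Killing vector fields); O'Neill 1983, Ch. 9, Def. 22 (p. 250) on the open submanifold `W`.
[cite: Nomizu1960, §1] -/
def HasLocalKillingGermAt (p : M) : Prop :=
  ∃ (W : Set M) (ξ : Π x : M, TangentSpace I x), IsOpen W ∧ p ∈ W ∧ g.IsKillingFieldOn ξ W ∧ ξ p ≠ 0

/-- **Causal local Killing germ at `p`**: a local Killing germ `(W, ξ)` at `p` whose value at `p` is
causal (non-spacelike) for `g`, `g_p(ξ(p), ξ(p)) ≤ 0` — for a Lorentzian `g`, the local form of a
stationary (timelike) or horizon/ergosurface-type (null) symmetry at `p`.  Nomizu 1960, §1;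
O'Neill 1983, Ch. 9, Def. 22. [cite: Nomizu1960, §1] -/
def HasCausalLocalKillingGermAt (p : M) : Prop :=
  ∃ (W : Set M) (ξ : Π x : M, TangentSpace I x), IsOpen W ∧ p ∈ W ∧ g.IsKillingFieldOn ξ W ∧
    ξ p ≠ 0 ∧ g.val p (ξ p) (ξ p) ≤ 0

variable {g}

/-- Unfolding lemma: the FLAT form of `HasLocalKillingGermAt` (smoothness on `W` and the Killing
equation on `W` spelled out, as route files inline it). [cite: Nomizu1960, §1] -/
theorem hasLocalKillingGermAt_iff {p : M} :
    g.HasLocalKillingGermAt p ↔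
      ∃ (W : Set M) (ξ : Π x : M, TangentSpace I x), IsOpen W ∧ p ∈ W ∧
        ContMDiffOn I (I.prod 𝓘(ℝ, E)) n
          (fun x ↦ (TotalSpace.mk' E x (ξ x) : TangentBundle I M)) W ∧
        (∀ x ∈ W, ∀ Y₀ Z₀ : TangentSpace I x,
          g.val x (g.leviCivita ξ x Y₀) Z₀ + g.val x Y₀ (g.leviCivita ξ x Z₀) = 0) ∧
        ξ p ≠ 0 := by
  constructor
  · rintro ⟨W, ξ, hW, hp, ⟨h₁, h₂⟩, hne⟩
    exact ⟨W, ξ, hW, hp, h₁, h₂, hne⟩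
  · rintro ⟨W, ξ, hW, hp, h₁, h₂, hne⟩
    exact ⟨W, ξ, hW, hp, ⟨h₁, h₂⟩, hne⟩

/-- Unfolding lemma: the FLAT form of `HasCausalLocalKillingGermAt`
(`∃ W ξ, IsOpen W ∧ p ∈ W ∧ ⟨Cⁿ on W⟩ ∧ ⟨Killing on W⟩ ∧ ξ p ≠ 0 ∧ g_p(ξ, ξ) ≤ 0`).
[cite: Nomizu1960, §1] -/
theorem hasCausalLocalKillingGermAt_iff {p : M} :
    g.HasCausalLocalKillingGermAt p ↔
      ∃ (W : Set M) (ξ : Π x : M, TangentSpace I x), IsOpen W ∧ p ∈ W ∧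
        ContMDiffOn I (I.prod 𝓘(ℝ, E)) n
          (fun x ↦ (TotalSpace.mk' E x (ξ x) : TangentBundle I M)) W ∧
        (∀ x ∈ W, ∀ Y₀ Z₀ : TangentSpace I x,
          g.val x (g.leviCivita ξ x Y₀) Z₀ + g.val x Y₀ (g.leviCivita ξ x Z₀) = 0) ∧
        ξ p ≠ 0 ∧ g.val p (ξ p) (ξ p) ≤ 0 := by
  constructor
  · rintro ⟨W, ξ, hW, hp, ⟨h₁, h₂⟩, hne, hle⟩
    exact ⟨W, ξ, hW, hp, h₁, h₂, hne, hle⟩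
  · rintro ⟨W, ξ, hW, hp, h₁, h₂, hne, hle⟩
    exact ⟨W, ξ, hW, hp, ⟨h₁, h₂⟩, hne, hle⟩

/-- A causal local Killing germ is a local Killing germ. [cite: Nomizu1960, §1] -/
theorem HasCausalLocalKillingGermAt.hasLocalKillingGermAt {p : M}
    (h : g.HasCausalLocalKillingGermAt p) : g.HasLocalKillingGermAt p := by
  obtain ⟨W, ξ, hW, hp, hK, hne, -⟩ := h
  exact ⟨W, ξ, hW, hp, hK, hne⟩

/-- **Monotonicity in the neighbourhood**: a local Killing germ at `p` can be realised on an open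
neighbourhood of `p` inside any prescribed open `V ∋ p` (restrict to `W ∩ V`; O'Neill 1983, Ch. 9,
Def. 22: Killing on an open set restricts to open subsets). [cite: ONeillSemiRiemannian1983, Ch. 9, Def. 22 (p. 250)] -/
theorem HasLocalKillingGermAt.exists_subset {p : M} (h : g.HasLocalKillingGermAt p) {V : Set M}
    (hV : IsOpen V) (hpV : p ∈ V) :
    ∃ (W : Set M) (ξ : Π x : M, TangentSpace I x), IsOpen W ∧ p ∈ W ∧ W ⊆ V ∧
      g.IsKillingFieldOn ξ W ∧ ξ p ≠ 0 := by
  obtain ⟨W, ξ, hW, hp, hK, hne⟩ := h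
  exact ⟨W ∩ V, ξ, hW.inter hV, ⟨hp, hpV⟩, inter_subset_right, hK.mono inter_subset_left, hne⟩

/-- Monotonicity in the neighbourhood, causal variant. [cite: ONeillSemiRiemannian1983, Ch. 9, Def. 22 (p. 250)] -/
theorem HasCausalLocalKillingGermAt.exists_subset {p : M} (h : g.HasCausalLocalKillingGermAt p)
    {V : Set M} (hV : IsOpen V) (hpV : p ∈ V) :
    ∃ (W : Set M) (ξ : Π x : M, TangentSpace I x), IsOpen W ∧ p ∈ W ∧ W ⊆ V ∧
      g.IsKillingFieldOn ξ W ∧ ξ p ≠ 0 ∧ g.val p (ξ p) (ξ p) ≤ 0 := by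
  obtain ⟨W, ξ, hW, hp, hK, hne, hle⟩ := h
  exact ⟨W ∩ V, ξ, hW.inter hV, ⟨hp, hpV⟩, inter_subset_right, hK.mono inter_subset_left, hne,
    hle⟩

section Global

/-- A global Killing field which does not vanish at `p` is a local Killing germ at `p` (take
`W = univ`). O'Neill 1983, Ch. 9, Def. 22. [cite: ONeillSemiRiemannian1983, Ch. 9, Def. 22 (p. 250)] -/
theorem IsKillingField.hasLocalKillingGermAt {ξ : Π x : M, TangentSpace I x}
    (h : g.IsKillingField ξ) {p : M} (hp : ξ p ≠ 0) : g.HasLocalKillingGermAt p :=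
  ⟨univ, ξ, isOpen_univ, mem_univ p, h.isKillingFieldOn univ, hp⟩

/-- A global Killing field which is non-zero and causal at `p` is a causal local Killing germ at
`p`. O'Neill 1983, Ch. 9, Def. 22. [cite: ONeillSemiRiemannian1983, Ch. 9, Def. 22 (p. 250)] -/
theorem IsKillingField.hasCausalLocalKillingGermAt {ξ : Π x : M, TangentSpace I x}
    (h : g.IsKillingField ξ) {p : M} (hp : ξ p ≠ 0) (hc : g.val p (ξ p) (ξ p) ≤ 0) :
    g.HasCausalLocalKillingGermAt p :=
  ⟨univ, ξ, isOpen_univ, mem_univ p, h.isKillingFieldOn univ, hp, hc⟩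

end Global

end PseudoRiemannianMetric

end Literature.Geometry.Lorentzian

end
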